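import Summits.MatrixMultiplication.OmegaCensus.DominoLineCertificate
import HarnessLib

/-!
# The unit obstruction to the normalised line identity, in any commutative ring (kernel form of the cell's "unit test")

ω-census `pub-omega`, family (b3), seat pub-omega-group gen 26.  Framing: lottery ticket; floor = certified bounds/negative
ranges.  VALUE: a theorem about the `ℤ_p`-quotient line identities of domino cube law triples (`DominoLineCertificate.lean`)
that turns the numerical "unit test" used by gens 19–25 to build the certificate tables into a kernel statement with a
TWO-NUMBER certificate per key; NOT progress on ω.

Setting (`DominoLineCertificate.line_identity_of_shifted_form`, `lineCert_sound`): `F, G : ZMod p → ℕ`, `s`, `K` with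
`Σ_v (F(τ−v) + F(v−τ) + F(τ+v))·G(v) + [s = τ] = K` for every `τ : ZMod p` (`p` prime).

* `line_char_identity`: for any commutative ring `R` and `r : R` with `Σ_{i<p} r^i = 0` (so `r^p = 1`), writing
  `a = Σ_v F(v) r^v`, `ā = Σ_v F(v) r^{−v}`, `b, b̄` likewise (`lev`, `levc`): `ab + āb + ab̄ + r^s = 0` — multiply the identity at `τ`
  by `r^τ` and sum (`K·Σ_τ r^τ = 0`).  Applied to the reflected data it gives the conjugate identity `āb̄ + ab̄ + āb + r^{−s} = 0`.
* `isUnit_lineD_of_line_identity` (`p ≥ 5`): `a² + aā + ā²` is a UNIT of `R`.  Proof: the polynomial identity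
  `(a²+aā+ā²)(b²+bb̄+b̄²) = u² − uū + ū²` for `u = ab+āb+ab̄`, `ū = āb̄+ab̄+āb`; here `u = −r^s`, `ū = −r^{−s}`, so the right side is
  `x − 1 + x⁻¹` with `x = r^{2s}`, and `(x − 1 + x⁻¹)·x·(1 + x) = 1 + x³`; for `s ≠ 0` both `1 + r^{2s}` and `1 + r^{6s}` are units because
  `y = r^k` (`k ≠ 0`) again satisfies `Σ_{i<p} y^i = 0`, whence `(1 + y)·(−(y + y³ + ⋯ + y^{p−2})) = 1` (`isUnit_one_add_of_geom_sum_eq_zero`);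
  for `s = 0` the right side is `1`.
* `no_line_identity_of_unit_cert` + the `Bool` checker `unitCert` / `unitCert_sound`: if `1 < q`, `Σ_{i<p} r^i ≡ 0 (mod q)` and
  `A² + AB + B² ≡ 0 (mod q)` for `A = Σ_v F(v) r^{v}`, `B = Σ_v F(v) r^{p − v}` (plain `ℕ` arithmetic), then NO `G, s, K` satisfy the line
  identity with this `F` — a unit of `ZMod q` cannot be `0`.  This is the certificate `(q, r)` (a prime `q ≡ 1 (mod p)` dividing the norm of
  `a² + aā + ā²` and a `p`-th root of unity mod `q` at which it vanishes) replacing the `p + 1` numbers of a modular Farkas certificate.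
In the language of the seat notes: a line key `F` can carry a solution only if `D(a_F) = a² + aā + ā²` is a unit of `ℤ[ζ_p]`.
-/

namespace Summit.MatrixMultiplication.OmegaCensus

open Finset

/-! ## Exponentials on `ZMod p` in a commutative ring -/

section Exponential

variable {p : ℕ} [Fact p.Prime] {R : Type*} [CommRing R]

/-- The exponential `v ↦ r ^ v.val` on `ZMod p`. [folklore] -/
def zch (r : R) (v : ZMod p) : R := r ^ v.val

omit [Fact p.Prime] in
/-- `Σ_{i<p} r^i = 0` forces `r^p = 1`. [folklore] -/
theorem pow_eq_one_of_geom_sum_eq_zero {r : R} (hr : ∑ i ∈ range p, r ^ i = 0) : r ^ p = 1 := by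
  have h := geom_sum_mul r p
  rw [hr, zero_mul] at h
  exact (sub_eq_zero.1 h.symm)

omit [Fact p.Prime] in
/-- Reduction of exponents mod `p` when `r^p = 1`. [folklore] -/
theorem pow_mod_eq_pow {r : R} (h : r ^ p = 1) (n : ℕ) : r ^ (n % p) = r ^ n := by
  conv_rhs => rw [← Nat.mod_add_div n p, pow_add, pow_mul, h, one_pow, mul_one]

/-- `zch r 0 = 1`. [folklore] -/
theorem zch_zero (r : R) : zch r (0 : ZMod p) = 1 := by
  rw [zch, ZMod.val_zero, pow_zero]

/-- Multiplicativity: `zch r (v + w) = zch r v * zch r w` when `r^p = 1`. [folklore] -/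
theorem zch_add {r : R} (h : r ^ p = 1) (v w : ZMod p) : zch r (v + w) = zch r v * zch r w := by
  haveI : NeZero p := ⟨(Fact.out : p.Prime).ne_zero⟩
  rw [zch, zch, zch, ZMod.val_add, pow_mod_eq_pow h, pow_add]

/-- `zch r v * zch r (-v) = 1` when `r^p = 1`. [folklore] -/
theorem zch_mul_zch_neg {r : R} (h : r ^ p = 1) (v : ZMod p) : zch r v * zch r (-v) = 1 := by
  rw [← zch_add h, add_neg_cancel, zch_zero]

/-- Powers: `zch r v ^ n = zch r (n * v)` when `r^p = 1`. [folklore] -/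
theorem zch_pow {r : R} (h : r ^ p = 1) (v : ZMod p) (n : ℕ) : zch r v ^ n = zch r ((n : ZMod p) * v) := by
  induction n with
  | zero => rw [pow_zero, Nat.cast_zero, zero_mul, zch_zero]
  | succ n ih => rw [pow_succ, ih, Nat.cast_succ, add_mul, one_mul, zch_add h]

/-- A sum over `ZMod p` of a function of `val` is the sum over `range p`. [folklore] -/
theorem sum_val_eq_sum_range {M : Type*} [AddCommMonoid M] (f : ℕ → M) :
    ∑ τ : ZMod p, f τ.val = ∑ i ∈ range p, f i := by
  haveI : NeZero p := ⟨(Fact.out : p.Prime).ne_zero⟩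
  refine Finset.sum_bij (fun τ _ => τ.val) (fun τ _ => mem_range.2 (ZMod.val_lt τ))
    (fun a _ b _ hab => ZMod.val_injective p hab) (fun i hi => ?_) (fun τ _ => rfl)
  exact ⟨(i : ZMod p), mem_univ _, ZMod.val_cast_of_lt (mem_range.1 hi)⟩

/-- `Σ_τ zch r τ = Σ_{i<p} r^i`. [folklore] -/
theorem sum_zch (r : R) : ∑ τ : ZMod p, zch r τ = ∑ i ∈ range p, r ^ i :=
  sum_val_eq_sum_range (fun i => r ^ i)

/-- For `k ≠ 0`, `y = zch r k` again satisfies `Σ_{i<p} y^i = 0`. [folklore] -/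
theorem geom_sum_zch_eq_zero {r : R} (hr : ∑ i ∈ range p, r ^ i = 0) {k : ZMod p} (hk : k ≠ 0) :
    ∑ i ∈ range p, (zch r k) ^ i = 0 := by
  have h := pow_eq_one_of_geom_sum_eq_zero hr
  have e1 : ∑ i ∈ range p, (zch r k) ^ i = ∑ τ : ZMod p, zch r (τ * k) := by
    rw [← sum_val_eq_sum_range (fun i => (zch r k) ^ i)]
    refine sum_congr rfl fun τ _ => ?_
    rw [zch_pow h, ZMod.natCast_zmod_val]
  rw [e1, Fintype.sum_equiv (Equiv.mulRight₀ k hk) (fun τ => zch r (τ * k)) (zch r) fun τ => rfl, sum_zch, hr]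

/-- `(1 + y)·Σ_{j<m} y^{2j+1} = Σ_{i<2m+1} y^i − 1` in any commutative ring. [folklore] -/
theorem one_add_mul_odd_geom_sum (y : R) (m : ℕ) :
    (1 + y) * ∑ j ∈ range m, y ^ (2 * j + 1) = (∑ i ∈ range (2 * m + 1), y ^ i) - 1 := by
  induction m with
  | zero => simp
  | succ m ih =>
    rw [Finset.sum_range_succ _ m, mul_add, ih, show 2 * (m + 1) + 1 = (2 * m + 1) + 1 + 1 by ring,
      Finset.sum_range_succ _ (2 * m + 1 + 1), Finset.sum_range_succ _ (2 * m + 1)]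
    ring

/-- `1 + y` is a unit when `Σ_{i<p} y^i = 0` (`p` an odd prime): `(1 + y)·(−Σ_{j<(p−1)/2} y^{2j+1}) = 1`. [folklore] -/
theorem isUnit_one_add_of_geom_sum_eq_zero (hp2 : p ≠ 2) {y : R} (hy : ∑ i ∈ range p, y ^ i = 0) :
    IsUnit (1 + y) := by
  obtain ⟨m, hm⟩ : ∃ m, p = 2 * m + 1 := by
    have hodd := (Fact.out : p.Prime).eq_one_or_self_of_dvd 2
    rcases Nat.even_or_odd p with ⟨k, hk⟩ | ⟨k, hk⟩
    · exfalso
      have h2 : 2 ∣ p := ⟨k, by omega⟩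
      rcases hodd h2 with h | h
      · exact absurd h (by decide)
      · exact hp2 h.symm
    · exact ⟨k, hk⟩
  rw [hm] at hy
  have key := one_add_mul_odd_geom_sum y m
  rw [hy, zero_sub] at key
  refine IsUnit.of_mul_eq_one (-(∑ j ∈ range m, y ^ (2 * j + 1))) ?_
  rw [mul_neg, key, neg_neg]

end Exponential

/-! ## The line identity through a character of `ZMod p` with values in `R` -/

section Character

variable {p : ℕ} [Fact p.Prime] {R : Type*} [CommRing R]

/-- `a = Σ_v F(v) r^v`. [folklore] -/
def lev (r : R) (F : ZMod p → ℕ) : R := ∑ v : ZMod p, (F v : R) * zch r v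

/-- `ā = Σ_v F(v) r^{−v}`. [folklore] -/
def levc (r : R) (F : ZMod p → ℕ) : R := ∑ v : ZMod p, (F v : R) * zch r (-v)

/-- Reflection turns `lev` into `levc`. [folklore] -/
theorem lev_reflect (r : R) (F : ZMod p → ℕ) : lev r (fun v => F (-v)) = levc r F := by
  unfold lev levc
  exact Fintype.sum_equiv (Equiv.neg (ZMod p)) _ _ fun v => by simp

/-- Reflection turns `levc` into `lev`. [folklore] -/
theorem levc_reflect (r : R) (F : ZMod p → ℕ) : levc r (fun v => F (-v)) = lev r F := by
  unfold lev levc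
  exact Fintype.sum_equiv (Equiv.neg (ZMod p)) _ _ fun v => by simp

/-- **The line identity through the character `v ↦ r^v`**: `ab + āb + ab̄ + r^s = 0`. [folklore] -/
theorem line_char_identity {r : R} (hr : ∑ i ∈ range p, r ^ i = 0) (F G : ZMod p → ℕ) (s : ZMod p) (K : ℕ)
    (hid : ∀ τ : ZMod p, (∑ v : ZMod p, (F (τ - v) + F (v - τ) + F (τ + v)) * G v) + (if s = τ then 1 else 0) = K) :
    lev r F * lev r G + levc r F * lev r G + lev r F * levc r G + zch r s = 0 := by
  have h1 := pow_eq_one_of_geom_sum_eq_zero hr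
  -- the identity at `τ`, cast to `R` and multiplied by `r^τ`
  have key : ∀ τ : ZMod p, (∑ v : ZMod p, (F (τ - v) : R) * G v * zch r τ) +
      (∑ v : ZMod p, (F (v - τ) : R) * G v * zch r τ) + (∑ v : ZMod p, (F (τ + v) : R) * G v * zch r τ) +
      (if s = τ then (1 : R) else 0) * zch r τ = (K : R) * zch r τ := by
    intro τ
    have h := congrArg (fun n : ℕ => (n : R) * zch r τ) (hid τ)
    push_cast at h
    rw [← h]
    simp only [add_mul, sum_mul, sum_add_distrib]
  have hsum := sum_congr rfl fun τ (_ : τ ∈ (univ : Finset (ZMod p))) => key τ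
  rw [← mul_sum, sum_zch, hr, mul_zero, sum_add_distrib, sum_add_distrib, sum_add_distrib] at hsum
  -- the four pieces
  have e1 : ∑ τ : ZMod p, ∑ v : ZMod p, (F (τ - v) : R) * G v * zch r τ = lev r F * lev r G := by
    unfold lev
    conv_rhs => rw [sum_mul_sum, sum_comm]
    rw [sum_comm]
    refine sum_congr rfl fun v _ => ?_
    rw [Fintype.sum_equiv (Equiv.subRight v) (fun τ => (F (τ - v) : R) * G v * zch r τ)
      (fun w => (F w : R) * G v * zch r (w + v)) fun τ => by simp]
    exact sum_congr rfl fun w _ => by rw [zch_add h1]; ring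
  have e2 : ∑ τ : ZMod p, ∑ v : ZMod p, (F (v - τ) : R) * G v * zch r τ = levc r F * lev r G := by
    unfold lev levc
    conv_rhs => rw [sum_mul_sum, sum_comm]
    rw [sum_comm]
    refine sum_congr rfl fun v _ => ?_
    rw [Fintype.sum_equiv (Equiv.subLeft v) (fun τ => (F (v - τ) : R) * G v * zch r τ)
      (fun w => (F w : R) * G v * zch r (v - w)) fun τ => by simp]
    exact sum_congr rfl fun w _ => by rw [sub_eq_add_neg, zch_add h1]; ring
  have e3 : ∑ τ : ZMod p, ∑ v : ZMod p, (F (τ + v) : R) * G v * zch r τ = lev r F * levc r G := by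
    unfold lev levc
    conv_rhs => rw [sum_mul_sum, sum_comm]
    rw [sum_comm]
    refine sum_congr rfl fun v _ => ?_
    rw [Fintype.sum_equiv (Equiv.addRight v) (fun τ => (F (τ + v) : R) * G v * zch r τ)
      (fun w => (F w : R) * G v * zch r (w - v)) fun τ => by simp]
    exact sum_congr rfl fun w _ => by rw [sub_eq_add_neg, zch_add h1]; ring
  have e4 : ∑ τ : ZMod p, (if s = τ then (1 : R) else 0) * zch r τ = zch r s := by
    simp only [ite_mul, one_mul, zero_mul, sum_ite_eq, mem_univ, if_true]
  rw [e1, e2, e3, e4] at hsum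
  exact hsum

/-- **The conjugate identity** `āb̄ + ab̄ + āb + r^{−s} = 0` (the character identity of the reflected data). [folklore] -/
theorem line_char_identity_conj {r : R} (hr : ∑ i ∈ range p, r ^ i = 0) (F G : ZMod p → ℕ) (s : ZMod p) (K : ℕ)
    (hid : ∀ τ : ZMod p, (∑ v : ZMod p, (F (τ - v) + F (v - τ) + F (τ + v)) * G v) + (if s = τ then 1 else 0) = K) :
    levc r F * levc r G + lev r F * levc r G + levc r F * lev r G + zch r (-s) = 0 := by
  have hid' : ∀ τ : ZMod p, (∑ v : ZMod p, (F (-(τ - v)) + F (-(v - τ)) + F (-(τ + v))) * G (-v)) +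
      (if -s = τ then 1 else 0) = K := by
    intro τ
    rw [← hid (-τ)]
    congr 1
    · refine Fintype.sum_equiv (Equiv.neg (ZMod p)) _ _ fun v => ?_
      rw [Equiv.neg_apply, show -(τ - v) = -τ - -v by abel, show -(v - τ) = -v - -τ by abel,
        show -(τ + v) = -τ + -v by abel]
    · by_cases h : s = -τ
      · rw [if_pos h, if_pos (by rw [h, neg_neg])]
      · rw [if_neg h, if_neg (fun h' => h (by rw [← h', neg_neg]))]
  have key := line_char_identity hr (fun v => F (-v)) (fun v => G (-v)) (-s) K hid'
  rw [lev_reflect, lev_reflect, levc_reflect, levc_reflect] at key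
  linear_combination key

/-- The polynomial identity behind the unit test: `(a²+aā+ā²)(b²+bb̄+b̄²) = u² − uū + ū²` for `u = ab+āb+ab̄`,
`ū = āb̄+ab̄+āb`. [folklore] -/
theorem lineD_mul_lineD (a a' b b' : R) :
    (a ^ 2 + a * a' + a' ^ 2) * (b ^ 2 + b * b' + b' ^ 2) =
      (a * b + a' * b + a * b') ^ 2 - (a * b + a' * b + a * b') * (a' * b' + a * b' + a' * b) +
        (a' * b' + a * b' + a' * b) ^ 2 := by
  ring

/-- `p ≥ 5` prime does not divide `6`: `(6 : ZMod p) ≠ 0`, hence `(2 : ZMod p) ≠ 0`. [folklore] -/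
theorem six_ne_zero_of_five_le (hp5 : 5 ≤ p) : (6 : ZMod p) ≠ 0 := by
  intro h
  have h' : ((6 : ℕ) : ZMod p) = 0 := by exact_mod_cast h
  rw [ZMod.natCast_eq_zero_iff] at h'
  have hle : p ≤ 6 := Nat.le_of_dvd (by norm_num) h'
  have hpr : p.Prime := Fact.out
  interval_cases p
  · exact absurd h' (by decide)
  · exact absurd hpr (by decide)

/-- **The unit obstruction.**  If the normalised line identity has a solution `G, s, K` then for every `r` with `Σ_{i<p} r^i = 0`
in a commutative ring (`p ≥ 5`), `a² + aā + ā²` is a unit (`a = Σ F(v) r^v`, `ā = Σ F(v) r^{−v}`). [folklore] -/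
theorem isUnit_lineD_of_line_identity (hp5 : 5 ≤ p) {r : R} (hr : ∑ i ∈ range p, r ^ i = 0) (F G : ZMod p → ℕ)
    (s : ZMod p) (K : ℕ)
    (hid : ∀ τ : ZMod p, (∑ v : ZMod p, (F (τ - v) + F (v - τ) + F (τ + v)) * G v) + (if s = τ then 1 else 0) = K) :
    IsUnit ((lev r F) ^ 2 + lev r F * levc r F + (levc r F) ^ 2) := by
  have h1 := pow_eq_one_of_geom_sum_eq_zero hr
  have hp2 : p ≠ 2 := by omega
  set a := lev r F with ha
  set a' := levc r F with ha'
  set b := lev r G with hb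
  set b' := levc r G with hb'
  set z := zch r s with hz
  set z' := zch r (-s) with hz'
  have hu : a * b + a' * b + a * b' = -z := eq_neg_of_add_eq_zero_left (line_char_identity hr F G s K hid)
  have hu' : a' * b' + a * b' + a' * b = -z' :=
    eq_neg_of_add_eq_zero_left (line_char_identity_conj hr F G s K hid)
  have hzz : z * z' = 1 := zch_mul_zch_neg h1 s
  -- `D(a) D(b) = z² − 1 + z'²`
  have hprod : (a ^ 2 + a * a' + a' ^ 2) * (b ^ 2 + b * b' + b' ^ 2) = z ^ 2 - 1 + z' ^ 2 := by
    rw [lineD_mul_lineD, hu, hu']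
    linear_combination -hzz
  -- the right-hand side is a unit
  have hunit : IsUnit (z ^ 2 - 1 + z' ^ 2) := by
    by_cases hs : s = 0
    · have hz1 : z = 1 := by rw [hz, hs, zch_zero]
      have hz1' : z' = 1 := by rw [hz', hs, neg_zero, zch_zero]
      rw [hz1, hz1']; norm_num
    · -- `x = z² = zch r (2s)`, `x³ = zch r (6s)`; `(z² − 1 + z'²)·x·(1+x) = 1 + x³`
      have h6 : (6 : ZMod p) ≠ 0 := six_ne_zero_of_five_le hp5
      have h2 : (2 : ZMod p) ≠ 0 := fun h => h6 (by linear_combination (3 : ZMod p) * h)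
      have hx : z ^ 2 = zch r (2 * s) := by rw [hz, zch_pow h1]; norm_num
      have hx3 : z ^ 6 = zch r (6 * s) := by rw [hz, zch_pow h1]; norm_num
      have hunit2 : IsUnit (1 + z ^ 2) := by
        rw [hx]; exact isUnit_one_add_of_geom_sum_eq_zero hp2 (geom_sum_zch_eq_zero hr (mul_ne_zero h2 hs))
      have hunit6 : IsUnit (1 + z ^ 6) := by
        rw [hx3]; exact isUnit_one_add_of_geom_sum_eq_zero hp2 (geom_sum_zch_eq_zero hr (mul_ne_zero h6 hs))
      have hfac : (z ^ 2 - 1 + z' ^ 2) * (z ^ 2 * (1 + z ^ 2)) = 1 + z ^ 6 := by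
        have hz'2 : z' ^ 2 * z ^ 2 = 1 := by linear_combination (z * z' + 1) * hzz
        linear_combination (1 + z ^ 2) * hz'2
      rw [← hfac] at hunit6
      exact isUnit_of_mul_isUnit_left hunit6
  rw [← hprod] at hunit
  exact isUnit_of_mul_isUnit_left hunit

/-- **No line identity when `a² + aā + ā² = 0` for some `r` with `Σ_{i<p} r^i = 0` in a nontrivial commutative ring.** [folklore] -/
theorem no_line_identity_of_lineD_eq_zero [Nontrivial R] (hp5 : 5 ≤ p) {r : R} (hr : ∑ i ∈ range p, r ^ i = 0)
    (F : ZMod p → ℕ) (hD : (lev r F) ^ 2 + lev r F * levc r F + (levc r F) ^ 2 = 0) (G : ZMod p → ℕ) (s : ZMod p) (K : ℕ)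
    (hid : ∀ τ : ZMod p, (∑ v : ZMod p, (F (τ - v) + F (v - τ) + F (τ + v)) * G v) + (if s = τ then 1 else 0) = K) :
    False := by
  have h := isUnit_lineD_of_line_identity hp5 hr F G s K hid
  rw [hD] at h
  exact not_isUnit_zero h

end Character

/-! ## The two-number certificate `(q, r)` and its `Bool` checker -/

section Cert

variable {p : ℕ} [Fact p.Prime]

/-- `A = Σ_v F(v)·r^{v}` in `ℕ`. [folklore] -/
def levNat (F : ZMod p → ℕ) (r : ℕ) : ℕ := ∑ v : ZMod p, F v * r ^ v.val

/-- `B = Σ_v F(v)·r^{(−v)}` in `ℕ`. [folklore] -/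
def levcNat (F : ZMod p → ℕ) (r : ℕ) : ℕ := ∑ v : ZMod p, F v * r ^ (-v).val

/-- **Unit-test certificate check** `(q, r)` for a line key `F`: `1 < q`, `Σ_{i<p} r^i ≡ 0 (mod q)`, and
`A² + AB + B² ≡ 0 (mod q)`. [folklore] -/
def unitCert (p : ℕ) [Fact p.Prime] (F : ZMod p → ℕ) (q r : ℕ) : Bool :=
  decide (1 < q ∧ (∑ i ∈ range p, r ^ i) % q = 0 ∧
    ((levNat F r) ^ 2 + levNat F r * levcNat F r + (levcNat F r) ^ 2) % q = 0)

/-- **Soundness of the unit-test certificate** (`p ≥ 5`): `unitCert p F q r = true` excludes every solution `G, s, K` of the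
normalised line identity with key `F`. [folklore] -/
theorem unitCert_sound (hp5 : 5 ≤ p) {F : ZMod p → ℕ} {q r : ℕ} (h : unitCert p F q r = true) (G : ZMod p → ℕ)
    (s : ZMod p) (K : ℕ)
    (hid : ∀ τ : ZMod p, (∑ v : ZMod p, (F (τ - v) + F (v - τ) + F (τ + v)) * G v) + (if s = τ then 1 else 0) = K) :
    False := by
  obtain ⟨hq, hr, hD⟩ := of_decide_eq_true h
  haveI : Fact (1 < q) := ⟨hq⟩
  have hr' : ∑ i ∈ range p, ((r : ZMod q)) ^ i = 0 := by
    have e := (ZMod.natCast_eq_zero_iff _ q).2 (Nat.dvd_of_mod_eq_zero hr)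
    push_cast at e
    exact e
  have hlev : lev (r : ZMod q) F = ((levNat F r : ℕ) : ZMod q) := by
    unfold lev levNat zch; push_cast; rfl
  have hlevc : levc (r : ZMod q) F = ((levcNat F r : ℕ) : ZMod q) := by
    unfold levc levcNat zch; push_cast; rfl
  refine no_line_identity_of_lineD_eq_zero hp5 hr' F ?_ G s K hid
  rw [hlev, hlevc]
  have e := (ZMod.natCast_eq_zero_iff _ q).2 (Nat.dvd_of_mod_eq_zero hD)
  push_cast at e
  exact e

/-- Worked instance (`p = 5`): the key `F = δ₃ + 2δ₄` (`[0,0,0,1,2]`, certified in `DominoZ5LineTables.table3` by a Farkas vector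
mod `31`) fails the unit test at `(q, r) = (31, 2)`: `2` has order `5` mod `31`, `A = 2³ + 2·2⁴ = 40`, `B = 2² + 2·2 = 8`, and
`A² + AB + B² = 1984 = 64·31`. [folklore] -/
theorem unitCert_example :
    @unitCert 5 ⟨Nat.prime_five⟩ (fun v : ZMod 5 => if v = 3 then 1 else if v = 4 then 2 else 0) 31 2 = true := by
  decide

end Cert

end Summit.MatrixMultiplication.OmegaCensus
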